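import Literature.MathematicalPhysics.QuantumLattice.LTQOProofs
import Literature.MathematicalPhysics.QuantumLattice.SectorEigenvalueContinuation
import HarnessLib

/-!
# Route `JosephsonMirror` — the floor dimension does not drop near a no-split coupling
# (crux `JmPairBridge`, stmt-HubbardSuperconductivity-2226, line `schur-rigid-bridge`, stub `stub_floorLower`)

Let `A u` (`u ∈ ℝ`) be Hermitian matrices on `ι → ℂ` preserving a subspace `K`, with quadratic forms
`d`-Lipschitz in `u` (`|Re⟨v, A u v⟩ - Re⟨v, A u' v⟩| ≤ d |u - u'| ‖v‖²`), and let `m u` be the bottom of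
`A u` on `K` — a lower bound of the form on `K` attained at an eigenvector in `K`. The FLOOR of `A u` in
`K` is `Fl u = K ⊓ eigenspace (A u) (m u)`. Assume that every `A u` has a strict gap `μ_u > m u` above its
floor on `K`, attained by an eigenvector whenever the orthocomplement of the floor inside `K` is
non-trivial (the output of `stub_floorGap`), and that near `U₀` no two DISTINCT eigenvalues of `A u`
(witnessed by non-zero eigenvectors) lie within `ρ` of `m U₀` (the output of `stub_noSplitNearGeneric`).
Then for `|u - U₀| < ρ / (2(d+1))` one has `dim Fl U₀ ≤ dim Fl u`.

Proof. The orthogonal compression `Fl U₀ → Fl u`, `w ↦ P_u w`, is injective, whence the dimension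
count. Indeed let `w ∈ Fl U₀` with `P_u w = 0`, i.e. `w ⊥ Fl u`. If the orthocomplement of `Fl u` in
`K` is trivial, `w = 0`. Otherwise let `φ` be the eigenvector of `A u` with eigenvalue `μ_u` there and
suppose `w ≠ 0`; with `r = d|u - U₀| < ρ/2`: `μ_u ‖w‖² ≤ Re⟨w, A u w⟩ ≤ Re⟨w, A U₀ w⟩ + r‖w‖² =
(m U₀ + r)‖w‖²`, so `μ_u ≤ m U₀ + r`; and for a ground vector `ψ` of `A u` in `K`,
`m u ‖ψ‖² = Re⟨ψ, A u ψ⟩ ≥ Re⟨ψ, A U₀ ψ⟩ - r‖ψ‖² ≥ (m U₀ - r)‖ψ‖²`, so `m u ≥ m U₀ - r`. Hence `m u`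
and `μ_u` are two distinct eigenvalues of `A u` within `ρ` of `m U₀` — excluded.

Sources: T. Kato, *Perturbation Theory for Linear Operators* (1966), Ch. II §5.1 (continuity of the
eigenvalues and of the total projection of a λ-group of a symmetric family); H. Tasaki, *Physics and
Mathematics of Quantum Many-Body Systems* (2020), §2.1 (variational principle). No definitions.
-/

noncomputable section

-- the mandated namespace `Summit.<Summit>.<Problem>.Theorems` repeats `HubbardSuperconductivity`
-- (single-problem summit, D-0017), which the `dupNamespace` linter flags on every declaration
set_option linter.dupNamespace false

namespace Summit.HubbardSuperconductivity.HubbardSuperconductivity.Theorems.JosephsonMirror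

open Matrix Literature.MathematicalPhysics.QuantumLattice
open Literature.MathematicalPhysics.QuantumLattice.EigenvalueContinuation

/-- For a Hermitian matrix `P`, `⟨P w, u⟩ = ⟨w, P u⟩`. [folklore] -/
private theorem floorLower_star_mulVec_dotProduct {ι : Type*} [Fintype ι] {P : Matrix ι ι ℂ}
    (hP : P.IsHermitian) (w u : ι → ℂ) : star (P *ᵥ w) ⬝ᵥ u = star w ⬝ᵥ P *ᵥ u := by
  rw [star_mulVec, ← dotProduct_mulVec, hP.eq]

/-- **STUB `stub_floorLower`** (the floor dimension does not drop near a no-split coupling).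
`A u` Hermitian matrices preserving `K` with `d`-Lipschitz quadratic forms, `m u` the bottom of `A u`
on `K` (lower bound attained at an eigenvector in `K`); every `A u` has a strict gap above its floor on
`K`, attained when the orthocomplement of the floor in `K` is non-trivial; and near `U₀` no two distinct
eigenvalues of `A u` lie within `ρ` of `m U₀`. Then for `u` near `U₀` the floor
`K ⊓ eigenspace (A u) (m u)` has dimension at least that of the floor at `U₀`: the orthogonal
compression of the `U₀`-floor into the `u`-floor is injective, since a non-zero ground vector of `A U₀`
orthogonal to the `u`-floor would push the SECOND eigenvalue of `A u` on `K` below `m U₀ + d|u - U₀|`,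
producing two distinct eigenvalues of `A u` near `m U₀`. Kato (1966) II §5.1; Tasaki (2020) §2.1.
[folklore] -/
theorem stub_floorLower {ι : Type*} [Fintype ι] [DecidableEq ι] (A : ℝ → Matrix ι ι ℂ)
    (hherm : ∀ u, (A u)ᴴ = A u) (K : Submodule ℂ (ι → ℂ)) (hinv : ∀ u, ∀ v ∈ K, A u *ᵥ v ∈ K)
    (d : ℝ) (hd : 0 ≤ d)
    (hlip : ∀ (u u' : ℝ) (v : ι → ℂ), |(star v ⬝ᵥ A u *ᵥ v).re - (star v ⬝ᵥ A u' *ᵥ v).re| ≤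
      d * |u - u'| * (star v ⬝ᵥ v).re)
    (m : ℝ → ℝ) (hm : ∀ (u : ℝ), ∀ v ∈ K, m u * (star v ⬝ᵥ v).re ≤ (star v ⬝ᵥ A u *ᵥ v).re)
    (hatt : ∀ u : ℝ, ∃ ψ ∈ K, ψ ≠ 0 ∧ A u *ᵥ ψ = (m u : ℂ) • ψ)
    (hgap : ∀ u : ℝ, ∃ μ : ℝ, m u < μ ∧
      (∀ w ∈ K, (∀ ψ ∈ K, A u *ᵥ ψ = (m u : ℂ) • ψ → star ψ ⬝ᵥ w = 0) →
        μ * (star w ⬝ᵥ w).re ≤ (star w ⬝ᵥ A u *ᵥ w).re) ∧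
      ((∀ w ∈ K, (∀ ψ ∈ K, A u *ᵥ ψ = (m u : ℂ) • ψ → star ψ ⬝ᵥ w = 0) → w = 0) ∨
        (∃ φ ∈ K, φ ≠ 0 ∧ (∀ ψ ∈ K, A u *ᵥ ψ = (m u : ℂ) • ψ → star ψ ⬝ᵥ φ = 0) ∧
          A u *ᵥ φ = (μ : ℂ) • φ)))
    (U₀ ρ : ℝ) (hρ : 0 < ρ)
    (hns : ∀ u : ℝ, |u - U₀| < ρ → ∀ (μ₁ μ₂ : ℝ) (ψ₁ ψ₂ : ι → ℂ), ψ₁ ≠ 0 →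
      A u *ᵥ ψ₁ = (μ₁ : ℂ) • ψ₁ → ψ₂ ≠ 0 → A u *ᵥ ψ₂ = (μ₂ : ℂ) • ψ₂ →
        |μ₁ - m U₀| < ρ → |μ₂ - m U₀| < ρ → μ₁ = μ₂) :
    ∃ ε : ℝ, 0 < ε ∧ ∀ u : ℝ, |u - U₀| < ε →
      Module.finrank ℂ ↥(K ⊓ Module.End.eigenspace (Matrix.toLin' (A U₀)) ((m U₀ : ℝ) : ℂ)) ≤
        Module.finrank ℂ ↥(K ⊓ Module.End.eigenspace (Matrix.toLin' (A u)) ((m u : ℝ) : ℂ)) := by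
  classical
  -- `hherm`/`hinv` are part of the registered signature; Hermiticity enters only through `hlip`,
  -- `hgap` and `hns` here, invariance not at all
  have _hh := hherm
  have _hi := hinv
  have hd1 : 0 < d + 1 := by linarith
  refine ⟨ρ / (2 * (d + 1)), by positivity, fun u hu => ?_⟩
  -- the two floors
  set F₀ : Submodule ℂ (ι → ℂ) :=
    K ⊓ Module.End.eigenspace (Matrix.toLin' (A U₀)) ((m U₀ : ℝ) : ℂ) with hF₀
  set F₁ : Submodule ℂ (ι → ℂ) :=
    K ⊓ Module.End.eigenspace (Matrix.toLin' (A u)) ((m u : ℝ) : ℂ) with hF₁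
  have hmem : ∀ (B : Matrix ι ι ℂ) (e : ℝ) (v : ι → ℂ),
      v ∈ K ⊓ Module.End.eigenspace (Matrix.toLin' B) ((e : ℝ) : ℂ) ↔
        v ∈ K ∧ B *ᵥ v = (e : ℂ) • v := fun B e v => by
    rw [Submodule.mem_inf, Module.End.mem_eigenspace_iff, Matrix.toLin'_apply]
  -- `r = d |u - U₀| < ρ / 2`, and `|u - U₀| < ρ`
  have hr : d * |u - U₀| < ρ / 2 := by
    have h1 : (d + 1) * |u - U₀| < (d + 1) * (ρ / (2 * (d + 1))) := mul_lt_mul_of_pos_left hu hd1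
    have h2 : (d + 1) * (ρ / (2 * (d + 1))) = ρ / 2 := by
      field_simp
    have h3 : d * |u - U₀| ≤ (d + 1) * |u - U₀| := by nlinarith [abs_nonneg (u - U₀)]
    linarith
  have huρ : |u - U₀| < ρ := by
    have h : ρ / (2 * (d + 1)) ≤ ρ := div_le_self hρ.le (by linarith)
    exact hu.trans_le h
  have hr0 : 0 ≤ d * |u - U₀| := mul_nonneg hd (abs_nonneg _)
  -- the orthogonal projection onto the `u`-floor
  set P : Matrix ι ι ℂ := projMatrix (F₁.map ((WithLp.linearEquiv 2 ℂ (ι → ℂ)).symm :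
      (ι → ℂ) →ₗ[ℂ] EuclideanSpace ℂ ι)) with hPdef
  have hPH : P.IsHermitian := projMatrix_isHermitian _
  have hPmem : ∀ x, P *ᵥ x ∈ F₁ := fun x => projMatrix_map_mulVec_mem F₁ x
  have hPfix : ∀ x ∈ F₁, P *ᵥ x = x := fun x hx => projMatrix_map_mulVec_of_mem F₁ hx
  -- CORE: a `U₀`-floor vector killed by `P` vanishes
  have hcore : ∀ w ∈ F₀, P *ᵥ w = 0 → w = 0 := by
    intro w hw hPw
    obtain ⟨hwK, hweig⟩ := (hmem _ _ w).1 hw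
    -- `w ⊥ Fl u`
    have horth : ∀ ψ ∈ K, A u *ᵥ ψ = (m u : ℂ) • ψ → star ψ ⬝ᵥ w = 0 := by
      intro ψ hψK hψ
      have hψF : ψ ∈ F₁ := (hmem _ _ ψ).2 ⟨hψK, hψ⟩
      rw [← hPfix ψ hψF, floorLower_star_mulVec_dotProduct hPH, hPw, dotProduct_zero]
    obtain ⟨μ, hμ, hbound, hdisj⟩ := hgap u
    rcases hdisj with hzero | ⟨φ, _, hφ0, -, hφeig⟩
    · exact hzero w hwK horth
    · by_contra hw0
      -- energies of `w`
      have hwpos : 0 < (star w ⬝ᵥ w).re := re_star_dotProduct_self_pos hw0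
      have hwU₀ : (star w ⬝ᵥ A U₀ *ᵥ w).re = m U₀ * (star w ⬝ᵥ w).re :=
        re_star_dotProduct_mulVec_of_eigen hweig
      have hlipw := (abs_sub_le_iff.1 (hlip u U₀ w)).1
      have hμw : μ * (star w ⬝ᵥ w).re ≤ (star w ⬝ᵥ A u *ᵥ w).re := hbound w hwK horth
      have hμle : μ ≤ m U₀ + d * |u - U₀| := by
        refine le_of_mul_le_mul_right ?_ hwpos
        have : (m U₀ + d * |u - U₀|) * (star w ⬝ᵥ w).re =
            m U₀ * (star w ⬝ᵥ w).re + d * |u - U₀| * (star w ⬝ᵥ w).re := by ring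
        linarith
      -- energies of a ground vector `ψ` of `A u` in `K`
      obtain ⟨ψ, hψK, hψ0, hψeig⟩ := hatt u
      have hψpos : 0 < (star ψ ⬝ᵥ ψ).re := re_star_dotProduct_self_pos hψ0
      have hψu : (star ψ ⬝ᵥ A u *ᵥ ψ).re = m u * (star ψ ⬝ᵥ ψ).re :=
        re_star_dotProduct_mulVec_of_eigen hψeig
      have hlipψ := (abs_sub_le_iff.1 (hlip u U₀ ψ)).2
      have hmψ := hm U₀ ψ hψK
      have hmge : m U₀ - d * |u - U₀| ≤ m u := by
        refine le_of_mul_le_mul_right ?_ hψpos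
        have : (m U₀ - d * |u - U₀|) * (star ψ ⬝ᵥ ψ).re =
            m U₀ * (star ψ ⬝ᵥ ψ).re - d * |u - U₀| * (star ψ ⬝ᵥ ψ).re := by ring
        linarith
      -- two distinct eigenvalues of `A u` near `m U₀`: excluded
      have h1 : |m u - m U₀| < ρ := by
        rw [abs_lt]
        constructor <;> linarith
      have h2 : |μ - m U₀| < ρ := by
        rw [abs_lt]
        constructor <;> linarith
      have key := hns u huρ (m u) μ ψ φ hψ0 hψeig hφ0 hφeig h1 h2
      exact absurd key (ne_of_lt hμ)
  -- the compression `F₀ → F₁`, `w ↦ P w`, is an injective linear map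
  let π : ↥F₀ →ₗ[ℂ] ↥F₁ :=
    LinearMap.codRestrict F₁ ((Matrix.toLin' P).domRestrict F₀) fun x => hPmem _
  have hπ : Function.Injective π := by
    intro x y hxy
    apply Subtype.ext
    have h := congrArg (fun z : ↥F₁ => (z : ι → ℂ)) hxy
    simp only [π, LinearMap.codRestrict_apply, LinearMap.domRestrict_apply, Matrix.toLin'_apply] at h
    have hsub : P *ᵥ ((x : ι → ℂ) - y) = 0 := by rw [mulVec_sub, h, sub_self]
    exact sub_eq_zero.1 (hcore _ (F₀.sub_mem x.2 y.2) hsub)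
  exact LinearMap.finrank_le_finrank_of_injective hπ

end Summit.HubbardSuperconductivity.HubbardSuperconductivity.Theorems.JosephsonMirror

end
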